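import Summits.QuantumFields.YangMills.Theorems.SmallFieldWideningLargeFieldMassRefinementTailProfileMono
import Summits.QuantumFields.YangMills.Theorems.SmallFieldWideningLargeFieldMassRefinementTailOfHeightTail
import Summits.QuantumFields.YangMills.Theses.UnitScaleTilt
import HarnessLib

/-!
# Route `SmallFieldWidening` — crux r3 `LargeFieldMassRefinementTail` (stmt-QuantumFields-22884) IN ITS RATED FORM IS A HUB: it implies
# BY BOOKKEEPING both K2 cruxes of route `UnitScaleTilt` (`HistoryTail` stmt-QuantumFields-18916, `HistoryTailL` stmt-QuantumFields-19936)
# and r3 itself, and it follows from every K2 feeder (support file; width seat `ym-line-sfw-p2-w3` gen 4, line `birth`)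

WHY.  r3 asks, for a family `F` and `γ > 0`, for ONE null sequence `δ n → 0` bounding, for every refinement depth `n` (`F.refine n` at
`γL^{-n} ≤ γ₁`) and EVERY run `K`, the Gibbs mass of the complement of the all-heights small-field event.  Every feeder the tree knows
(the registered stub `stub_avgTailPkg` = the averaged-heights package `AveragedTailAt`, K2's `HeightTailAt`, one (α) χ-record, the 2′χ socket)
delivers MORE: `δ n = Σ_{t ≥ n − n₀} q(t)` for a profile `q` with `Σ_n Σ'_t q(t + n) < ∞`, i.e. a SUMMABLE `δ` (§3).  Call «r3⁺» the filed
statement with `Tendsto δ atTop (𝓝 0)` replaced by `Summable δ` (spelled out below as a hypothesis; no new definition).  The point of this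
file: r3⁺ is not a route-private currency — it implies, by the level shift «run `K` of `F.refine d` at `γL^{-d}` = run `K + d` of `F` with `d`
FREE TOP STEPS» (sibling file `…OfHeightTail`, `gibbsK_refine_real_compl_histGood`) read BACKWARDS, the K2 bodies of route `UnitScaleTilt`
for EVERY free top fraction `1/m` with ONE profile for all `m` (§2): run `K` with `⌊K/m⌋` free top steps is run `K − ⌊K/m⌋` of
`F.refine ⌊K/m⌋`, so its bad-history mass is `≤ δ ⌊K/m⌋`, and `K ↦ δ ⌊K/m⌋` is summable (each value repeated `m` times, §1).

WHAT (all sorry-free; the r3⁺ hypothesis is displayed verbatim in each statement).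
* §1 `summable_abs_comp_div` — `Σ_K |δ ⌊K/m⌋| < ∞` from `Σ δ` summable (`m ≥ 1`); `summable_comp_sub`.
* §2 ONE FAMILY: `mass_freeTopSteps_le` (the r3⁺ body at `(F, γ ≤ γ₁)` bounds run `N` of `F` with `d ≤ N` free top steps by `δ d`),
  ★ `historyTailAt_of_rated` (`⇒ HistoryTailAt F γ b₀ p₀ m` for every `m ≥ 1`, `w K = |δ ⌊K/m⌋|`).
* §3 ROUTE LEVEL: ★★ `historyTail_of_rated : r3⁺ → Theses.UnitScaleTilt.HistoryTail`, ★★ `historyTailL_of_rated : r3⁺ → Theses.UnitScaleTilt.HistoryTailL`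
  (thresholds `(b₁, p₁)` served by `(max b₀ b₁, max p₀ p₁)` through the lead's `refinedMass_mono_profile`, `γ₁ ↦ min γ₁ 1`),
  `largeFieldMassRefinementTail_of_rated : r3⁺ → r3` (`Summable.tendsto_atTop_zero`).
* §4 FEEDERS: `exists_summable_mass_bound` (w2's `exists_null_mass_bound` keeping the double-summability clause of `HeightTailAt`),
  ★ `rated_of_heightTail`, ★ `rated_of_averagedTail` (the registered stub text of crux 22884's skeleton v5 ⇒ r3⁺).
Consequence recorded for the planner (D-0014): on the LARGE-FIELD side the route's «TIGHTEN» (K-uniform `o(1)` instead of summable) buys nothing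
relative to `UnitScaleTilt` once the natural rate is kept — r3⁺ ⟹ 18916 ∧ 19936 ∧ 22884 — while r3 AS FILED (no rate) is NOT downstream of the
ITEMS 18916/19936 (their free top fraction `1/m` is positive, r3's `n/(n+K)` is not): 22884 should be parked behind the all-heights (α) package
(`AveragedTailAt` / `AlphaInputsT3AC.IntCoreRec`), of which ONE χ-record per odd `L` is the weakest sufficient instance (sibling `…RatedOfOneRecord`).

WHAT THIS IS NOT: no large-field estimate is proved; r3, K2, K2-L stay OPEN (their common located content is Bałaban's (71) summed under the
interacting law, the 2′χ socket `AlphaInputsT3ACv3RecChi`); nothing here bears on d = 4 or the Yang–Mills mass gap (rung R3 record only).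

References: T. Bałaban, CMP 102 (1985) 255–275 [Balaban1985UV3] ((1)–(3) p.256, (7) p.257, (71) p.273); C. King, CMP 102 (1986) 649–677
[King1986] ((3.12) p.657: the free top fraction).
-/

set_option autoImplicit false

noncomputable section

open MeasureTheory Filter Topology
open scoped BigOperators
open Literature.MathematicalPhysics.QuantumFieldTheory.Balaban1983to89
open Literature.MathematicalPhysics.QuantumFieldTheory.Balaban1983to89.Missing
open Literature.MathematicalPhysics.QuantumFieldTheory.Balaban1983to89.T3ContinuumYM3Torus
open Literature.MathematicalPhysics.QuantumFieldTheory.Balaban1983to89.T3UnitScaleTilt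
open Literature.MathematicalPhysics.QuantumFieldTheory.Balaban1983to89.T3UnitLawDensityEML
open Literature.MathematicalPhysics.QuantumFieldTheory.Balaban1983to89.T3CruxEstimates
open Literature.MathematicalPhysics.QuantumFieldTheory.Balaban1983to89.T3BareTailProfile
open Summit.QuantumFields.YangMills.Theorems.LargeFieldMassRefinementTailOfHeightTail
  (θBal_mul_pow gibbsK_refine_real_compl_histGood gibbsK_refine_real_compl_histGood_le_tsum refine_refine)
open Summit.QuantumFields.YangMills.Theorems.LargeFieldMassRefinementTailProfileMono (refinedMass_mono_profile)

namespace Summit.QuantumFields.YangMills.Theorems.LargeFieldMassRefinementTailRated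

/-! ## §1 Two summability lemmas -/

/-- A summable sequence read through `n ↦ n − n₀` (the first value repeated `n₀ + 1` times) is summable. [folklore] -/
theorem summable_comp_sub {g : ℕ → ℝ} (hg : Summable g) (n₀ : ℕ) : Summable fun n => g (n - n₀) := by
  refine (summable_nat_add_iff n₀).mp ?_
  simpa only [Nat.add_sub_cancel] using hg

/-- `Σ_{K < m·M} |δ ⌊K/m⌋| = m · Σ_{n < M} |δ n|` (each value is repeated `m` times). [folklore] -/
theorem sum_range_mul_abs_comp_div (δ : ℕ → ℝ) {m : ℕ} (hm : 0 < m) (M : ℕ) :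
    ∑ K ∈ Finset.range (m * M), |δ (K / m)| = (m : ℝ) * ∑ n ∈ Finset.range M, |δ n| := by
  induction M with
  | zero => simp
  | succ M ih =>
    rw [Nat.mul_succ, Finset.sum_range_add, ih, Finset.sum_range_succ, mul_add]
    congr 1
    have hconst : ∀ r ∈ Finset.range m, |δ ((m * M + r) / m)| = |δ M| := by
      intro r hr
      rw [Finset.mem_range] at hr
      rw [Nat.mul_add_div hm, Nat.div_eq_of_lt hr, Nat.add_zero]
    rw [Finset.sum_congr rfl hconst, Finset.sum_const, Finset.card_range, nsmul_eq_mul]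

/-- **`K ↦ |δ ⌊K/m⌋|` IS SUMMABLE** when `δ` is (`m ≥ 1`): partial sums are `≤ m · Σ |δ|`. [folklore] -/
theorem summable_abs_comp_div {δ : ℕ → ℝ} (hδ : Summable δ) {m : ℕ} (hm : 0 < m) :
    Summable fun K => |δ (K / m)| := by
  have habs : Summable fun n => |δ n| := hδ.abs
  refine summable_of_sum_range_le (c := (m : ℝ) * ∑' n, |δ n|) (fun _ => abs_nonneg _) fun N => ?_
  have hN : N ≤ m * (N / m + 1) := by
    rw [Nat.mul_add, Nat.mul_one]
    exact (Nat.lt_div_mul_add hm).le |>.trans (by rw [Nat.mul_comm])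
  calc ∑ K ∈ Finset.range N, |δ (K / m)|
      ≤ ∑ K ∈ Finset.range (m * (N / m + 1)), |δ (K / m)| :=
        Finset.sum_le_sum_of_subset_of_nonneg (Finset.range_mono hN) fun _ _ _ => abs_nonneg _
    _ = (m : ℝ) * ∑ n ∈ Finset.range (N / m + 1), |δ n| := sum_range_mul_abs_comp_div δ hm _
    _ ≤ (m : ℝ) * ∑' n, |δ n| :=
        mul_le_mul_of_nonneg_left (habs.sum_le_tsum _ fun _ _ => abs_nonneg _) (Nat.cast_nonneg m)

/-! ## §2 One family: the rated all-heights masses bound every K2 body of route `UnitScaleTilt` -/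

section OneFamily

variable (F : T3Family) {γ γ₁ b₀ p₀ : ℝ} {δ : ℕ → ℝ}

/-- **THE LEVEL SHIFT READ BACKWARDS**: if for the family `F` at `0 < γ ≤ γ₁` the complement masses of the all-heights events of the refined runs
(`F.refine n` at `γL^{-n} ≤ γ₁`, every `K`) are `≤ δ n`, then for every run `N` of `F` itself and every `d ≤ N` the Gibbs mass of the complement of
Bałaban's UV-small-history event WITH `d` FREE TOP STEPS, `histGood F … N d`, is `≤ δ d` — run `N` of `F` at `γ` IS run `N − d` of `F.refine d` at
`γL^{-d}` (`gibbsK_refine_real_compl_histGood`, thresholds `θ_{γL^{-d}}(i) = θ_γ(i + d)`), and `γL^{-d} ≤ γ ≤ γ₁`. [cite: Balaban1985UV3, (1)-(3) p.256 and (7) p.257] -/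
theorem mass_freeTopSteps_le (hγ : 0 < γ) (hγ1 : γ ≤ γ₁)
    (h : ∀ n K : ℕ, γ * ((F.L : ℝ)⁻¹) ^ n ≤ γ₁ →
      (gibbsK (F.refine n) ℰp (γ * ((F.L : ℝ)⁻¹) ^ n) K).real
        (histGood (F.refine n) ℰp (θBal (F.refine n).L (γ * ((F.L : ℝ)⁻¹) ^ n) b₀ p₀) K 0)ᶜ ≤ δ n)
    (N d : ℕ) (hd : d ≤ N) :
    (gibbsK F ℰp γ N).real (histGood F ℰp (θBal F.L γ b₀ p₀) N d)ᶜ ≤ δ d := by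
  have hL0 : (0 : ℝ) ≤ ((F.L : ℝ))⁻¹ := inv_nonneg.mpr (Nat.cast_nonneg _)
  have hL1 : ((F.L : ℝ))⁻¹ ≤ 1 := Nat.cast_inv_le_one F.L
  have hle : γ * ((F.L : ℝ)⁻¹) ^ d ≤ γ₁ := (mul_le_of_le_one_right hγ.le (pow_le_one₀ hL0 hL1)).trans hγ1
  have hθ : θBal (F.refine d).L (γ * ((F.L : ℝ)⁻¹) ^ d) b₀ p₀ = fun i => θBal F.L γ b₀ p₀ (i + d) :=
    funext fun i => θBal_mul_pow F.L γ b₀ p₀ d i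
  have key := h d (N - d) hle
  rw [hθ, gibbsK_refine_real_compl_histGood F ℰp measurableE_ℰp hγ.le (θBal F.L γ b₀ p₀) d (N - d),
    Nat.sub_add_cancel hd] at key
  exact key

/-- ★ **K2's BODY AT EVERY FREE TOP FRACTION FROM THE RATED ALL-HEIGHTS MASSES**: under the hypothesis of `mass_freeTopSteps_le` with `Σ δ`
summable, `HistoryTailAt F γ b₀ p₀ m` holds for every `m ≥ 1`, with `w K := |δ ⌊K/m⌋|` (run `K` and run `K + 1` both have `≥ ⌊K/m⌋` heights;
`summable_abs_comp_div`).  ONE profile, ONE `γ₁`, every `m`. [cite: Balaban1985UV3, (7) p.257 and (71) p.273; King1986, (3.12) p.657] -/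
theorem historyTailAt_of_rated (hγ : 0 < γ) (hγ1 : γ ≤ γ₁) (hδ : Summable δ)
    (h : ∀ n K : ℕ, γ * ((F.L : ℝ)⁻¹) ^ n ≤ γ₁ →
      (gibbsK (F.refine n) ℰp (γ * ((F.L : ℝ)⁻¹) ^ n) K).real
        (histGood (F.refine n) ℰp (θBal (F.refine n).L (γ * ((F.L : ℝ)⁻¹) ^ n) b₀ p₀) K 0)ᶜ ≤ δ n)
    {m : ℕ} (hm : 0 < m) : HistoryTailAt F γ b₀ p₀ m := by
  refine ⟨fun K => |δ (K / m)|, summable_abs_comp_div hδ hm, fun K => ⟨?_, ?_⟩⟩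
  · exact (mass_freeTopSteps_le F hγ hγ1 h K (K / m) (Nat.div_le_self K m)).trans (le_abs_self _)
  · exact (mass_freeTopSteps_le F hγ hγ1 h (K + 1) (K / m) ((Nat.div_le_self K m).trans (Nat.le_succ K))).trans
      (le_abs_self _)

end OneFamily

/-! ## §3 Route level: r3⁺ ⇒ `HistoryTail` (18916), `HistoryTailL` (19936), `LargeFieldMassRefinementTail` (22884) -/

section Routes

/-- ★★ **r3⁺ ⇒ crux K2 `HistoryTail` OF ROUTE `UnitScaleTilt` (stmt-QuantumFields-18916) BY NAME** — for every `m` the SAME profile and `γ₁`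
(`historyTailAt_of_rated` per family). [cite: Balaban1985UV3, (7) p.257 and (71) p.273; King1986, (3.12) p.657] -/
theorem historyTail_of_rated
    (h : ∀ L : ℕ, ∃ b₀ p₀ γ₁ : ℝ, 0 < b₀ ∧ 2 < p₀ ∧ 0 < γ₁ ∧
      ∀ (F : T3Family) (γ : ℝ), F.L = L → 0 < γ → ∃ δ : ℕ → ℝ, Summable δ ∧
        ∀ n K : ℕ, γ * ((F.L : ℝ)⁻¹) ^ n ≤ γ₁ →
          (gibbsK (F.refine n) ℰp (γ * ((F.L : ℝ)⁻¹) ^ n) K).real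
            (histGood (F.refine n) ℰp (θBal (F.refine n).L (γ * ((F.L : ℝ)⁻¹) ^ n) b₀ p₀) K 0)ᶜ ≤ δ n) :
    Summit.QuantumFields.YangMills.Theses.UnitScaleTilt.HistoryTail := by
  intro L m hm
  obtain ⟨b₀, p₀, γ₁, hb, hp, hγ₁, hF⟩ := h L
  refine ⟨b₀, p₀, γ₁, hb, hp, hγ₁, fun F γ hFL hγ hle => ?_⟩
  obtain ⟨δ, hδ, hmass⟩ := hF F γ hFL hγ
  exact historyTailAt_of_rated F hγ hle hδ hmass hm

/-- ★★ **r3⁺ ⇒ crux K2-L `HistoryTailL` OF ROUTE `UnitScaleTilt` (stmt-QuantumFields-19936) BY NAME** — thresholds `(b₁, p₁)` are served by the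
profile `(max b₀ b₁, max p₀ p₁)` with the SAME `δ` (the lead's `refinedMass_mono_profile`: larger thresholds, smaller large-field masses, on
couplings `≤ min γ₁ 1`), the profile is fixed BEFORE `m`, and `historyTailAt_of_rated` serves every `m`.
[cite: Balaban1985UV3, (7) p.257 and (71) p.273; King1986, (3.12) p.657] -/
theorem historyTailL_of_rated
    (h : ∀ L : ℕ, ∃ b₀ p₀ γ₁ : ℝ, 0 < b₀ ∧ 2 < p₀ ∧ 0 < γ₁ ∧
      ∀ (F : T3Family) (γ : ℝ), F.L = L → 0 < γ → ∃ δ : ℕ → ℝ, Summable δ ∧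
        ∀ n K : ℕ, γ * ((F.L : ℝ)⁻¹) ^ n ≤ γ₁ →
          (gibbsK (F.refine n) ℰp (γ * ((F.L : ℝ)⁻¹) ^ n) K).real
            (histGood (F.refine n) ℰp (θBal (F.refine n).L (γ * ((F.L : ℝ)⁻¹) ^ n) b₀ p₀) K 0)ᶜ ≤ δ n) :
    Summit.QuantumFields.YangMills.Theses.UnitScaleTilt.HistoryTailL := by
  intro L b₁ p₁
  obtain ⟨b₀, p₀, γ₁, hb, hp, hγ₁, hF⟩ := h L
  refine ⟨max b₀ b₁, max p₀ p₁, le_max_right _ _, le_max_right _ _, hb.trans_le (le_max_left _ _),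
    hp.trans_le (le_max_left _ _), fun m hm => ⟨min γ₁ 1, lt_min hγ₁ one_pos, fun F γ hFL hγ hle => ?_⟩⟩
  obtain ⟨δ, hδ, hmass⟩ := hF F γ hFL hγ
  exact historyTailAt_of_rated F hγ hle hδ
    (refinedMass_mono_profile F hγ (min_le_left γ₁ 1) (min_le_right γ₁ 1) hb.le (le_max_left _ _) (le_max_left _ _) hmass) hm

/-- **r3⁺ ⇒ r3 `LargeFieldMassRefinementTail` (stmt-QuantumFields-22884) BY NAME** — a summable sequence tends to `0`. [cite: Balaban1985UV3, (7) p.257] -/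
theorem largeFieldMassRefinementTail_of_rated
    (h : ∀ L : ℕ, ∃ b₀ p₀ γ₁ : ℝ, 0 < b₀ ∧ 2 < p₀ ∧ 0 < γ₁ ∧
      ∀ (F : T3Family) (γ : ℝ), F.L = L → 0 < γ → ∃ δ : ℕ → ℝ, Summable δ ∧
        ∀ n K : ℕ, γ * ((F.L : ℝ)⁻¹) ^ n ≤ γ₁ →
          (gibbsK (F.refine n) ℰp (γ * ((F.L : ℝ)⁻¹) ^ n) K).real
            (histGood (F.refine n) ℰp (θBal (F.refine n).L (γ * ((F.L : ℝ)⁻¹) ^ n) b₀ p₀) K 0)ᶜ ≤ δ n) :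
    Summit.QuantumFields.YangMills.Theses.SmallFieldWidening.LargeFieldMassRefinementTail := by
  intro L
  obtain ⟨b₀, p₀, γ₁, hb, hp, hγ₁, hF⟩ := h L
  refine ⟨b₀, p₀, γ₁, hb, hp, hγ₁, fun F γ hFL hγ => ?_⟩
  obtain ⟨δ, hδ, hmass⟩ := hF F γ hFL hγ
  exact ⟨δ, hδ.tendsto_atTop_zero, hmass⟩

end Routes

/-! ## §4 Every K2 feeder delivers the rate: r3⁺ from `HeightTailAt` / `AveragedTailAt` packages -/

section Feeders

/-- **ONE SUMMABLE SEQUENCE FOR ALL RUNS OF ALL ADMISSIBLE REFINEMENTS** (w2's `exists_null_mass_bound` with the rate kept): if every admissible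
refinement (`γL^{-n} ≤ γ₁`) of `F` carries K2's per-height estimate `HeightTailAt`, then `δ n := Σ'_t q(t + (n − n₀))` — `q` the profile of the LEAST
admissible depth `n₀` — bounds the complement masses of the all-heights events of every run of `F.refine n`, `γL^{-n} ≤ γ₁`, and `Σ_n δ n < ∞` by
the double-summability clause `Σ_n Σ'_t q(t + n) < ∞` of `HeightTailAt`. [cite: Balaban1985UV3, (7) p.257 and (71) p.273] -/
theorem exists_summable_mass_bound (F : T3Family) {γ γ₁ b₀ p₀ : ℝ} (hγ : 0 < γ)
    (H : ∀ n : ℕ, γ * ((F.L : ℝ)⁻¹) ^ n ≤ γ₁ → HeightTailAt (F.refine n) (γ * ((F.L : ℝ)⁻¹) ^ n) b₀ p₀) :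
    ∃ δ : ℕ → ℝ, Summable δ ∧ ∀ n K : ℕ, γ * ((F.L : ℝ)⁻¹) ^ n ≤ γ₁ →
      (gibbsK (F.refine n) ℰp (γ * ((F.L : ℝ)⁻¹) ^ n) K).real
        (histGood (F.refine n) ℰp (θBal (F.refine n).L (γ * ((F.L : ℝ)⁻¹) ^ n) b₀ p₀) K 0)ᶜ ≤ δ n := by
  classical
  by_cases hex : ∃ n : ℕ, γ * ((F.L : ℝ)⁻¹) ^ n ≤ γ₁
  · have hn₀ : γ * ((F.L : ℝ)⁻¹) ^ Nat.find hex ≤ γ₁ := Nat.find_spec hex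
    obtain ⟨q, hq0, hq, hqt, htail⟩ := H (Nat.find hex) hn₀
    have hL0 : (0 : ℝ) < F.L := by exact_mod_cast (zero_lt_one.trans F.hL.2)
    have hγ' : 0 ≤ γ * ((F.L : ℝ)⁻¹) ^ Nat.find hex := (mul_pos hγ (pow_pos (inv_pos.mpr hL0) _)).le
    refine ⟨fun n => ∑' t, q (t + (n - Nat.find hex)), summable_comp_sub hqt (Nat.find hex), fun n K hle => ?_⟩
    have hn : Nat.find hex ≤ n := Nat.find_min' hex hle
    obtain ⟨d, rfl⟩ : ∃ d, n = Nat.find hex + d := ⟨n - Nat.find hex, by omega⟩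
    have hd : Nat.find hex + d - Nat.find hex = d := Nat.add_sub_cancel_left _ _
    have hc : γ * ((F.L : ℝ)⁻¹) ^ (Nat.find hex + d) =
        γ * ((F.L : ℝ)⁻¹) ^ Nat.find hex * ((F.L : ℝ)⁻¹) ^ d := by rw [pow_add, mul_assoc]
    beta_reduce
    rw [hd, hc, ← refine_refine F (Nat.find hex) d]
    exact gibbsK_refine_real_compl_histGood_le_tsum (F.refine (Nat.find hex)) hγ' b₀ p₀ hq0 hq htail d K
  · exact ⟨fun _ => 0, summable_zero, fun n K hle => (hex ⟨n, hle⟩).elim⟩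

/-- ★ **r3⁺ ⇐ K2's PER-HEIGHT ESTIMATE PACKAGE** (`∀ L, ∃ (b₀, p₀, γ₁), ∀ F (F.L = L) ∀ 0 < γ ≤ γ₁, HeightTailAt F γ b₀ p₀` = hypothesis `h2` of
`T3CruxEstimates.continuumYM3Torus_of_heightEstimates`). [cite: Balaban1985UV3, (7) p.257 and (71) p.273] -/
theorem rated_of_heightTail
    (h : ∀ L : ℕ, ∃ b₀ p₀ γ₁ : ℝ, 0 < b₀ ∧ 2 < p₀ ∧ 0 < γ₁ ∧
      ∀ (F : T3Family) (γ : ℝ), F.L = L → 0 < γ → γ ≤ γ₁ → HeightTailAt F γ b₀ p₀) :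
    ∀ L : ℕ, ∃ b₀ p₀ γ₁ : ℝ, 0 < b₀ ∧ 2 < p₀ ∧ 0 < γ₁ ∧
      ∀ (F : T3Family) (γ : ℝ), F.L = L → 0 < γ → ∃ δ : ℕ → ℝ, Summable δ ∧
        ∀ n K : ℕ, γ * ((F.L : ℝ)⁻¹) ^ n ≤ γ₁ →
          (gibbsK (F.refine n) ℰp (γ * ((F.L : ℝ)⁻¹) ^ n) K).real
            (histGood (F.refine n) ℰp (θBal (F.refine n).L (γ * ((F.L : ℝ)⁻¹) ^ n) b₀ p₀) K 0)ᶜ ≤ δ n := by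
  intro L
  obtain ⟨b₀, p₀, γ₁, hb₀, hp₀, hγ₁, H⟩ := h L
  refine ⟨b₀, p₀, γ₁, hb₀, hp₀, hγ₁, fun F γ hFL hγ => ?_⟩
  have hL0 : (0 : ℝ) < F.L := by exact_mod_cast (zero_lt_one.trans F.hL.2)
  exact exists_summable_mass_bound F hγ fun n hn =>
    H (F.refine n) _ hFL (mul_pos hγ (pow_pos (inv_pos.mpr hL0) n)) hn

/-- ★ **r3⁺ ⇐ THE BLOCK-AVERAGED HEIGHTS ALONE** — the registered stub text of crux 22884's skeleton v5 (`stub_avgTailPkg`: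
`∀ L, ∃ (b₀, p₀), ∃ γ₁ ≤ 1, ∀ F (F.L = L) ∀ 0 < γ ≤ γ₁, AveragedTailAt F γ b₀ p₀`; the bare height is the theorem `T3BareTailProfile.bareTailAt`).
[cite: Balaban1985UV3, (71) p.273] -/
theorem rated_of_averagedTail
    (h : ∀ L : ℕ, ∃ b₀ p₀ γ₁ : ℝ, 0 < b₀ ∧ 2 < p₀ ∧ 0 < γ₁ ∧ γ₁ ≤ 1 ∧
      ∀ (F : T3Family) (γ : ℝ), F.L = L → 0 < γ → γ ≤ γ₁ → AveragedTailAt F γ b₀ p₀) :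
    ∀ L : ℕ, ∃ b₀ p₀ γ₁ : ℝ, 0 < b₀ ∧ 2 < p₀ ∧ 0 < γ₁ ∧
      ∀ (F : T3Family) (γ : ℝ), F.L = L → 0 < γ → ∃ δ : ℕ → ℝ, Summable δ ∧
        ∀ n K : ℕ, γ * ((F.L : ℝ)⁻¹) ^ n ≤ γ₁ →
          (gibbsK (F.refine n) ℰp (γ * ((F.L : ℝ)⁻¹) ^ n) K).real
            (histGood (F.refine n) ℰp (θBal (F.refine n).L (γ * ((F.L : ℝ)⁻¹) ^ n) b₀ p₀) K 0)ᶜ ≤ δ n :=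
  rated_of_heightTail fun L => by
    obtain ⟨b₀, p₀, γ₁, hb, hp, hγ₁, hγ₁1, h⟩ := h L
    exact ⟨b₀, p₀, γ₁, hb, hp, hγ₁, fun F γ hFL hγ hle =>
      (heightTailAt_iff_averagedTailAt F hγ (hle.trans hγ₁1) hb (by linarith)).mpr (h F γ hFL hγ hle)⟩

/-- **THE HUB, CLOSED UP**: the averaged-heights package (crux 22884's registered stub text) implies `HistoryTailL` (stmt-QuantumFields-19936) —
one profile for every `m`, every pair of thresholds. [cite: Balaban1985UV3, (71) p.273; King1986, (3.12) p.657] -/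
theorem historyTailL_of_averagedTail
    (h : ∀ L : ℕ, ∃ b₀ p₀ γ₁ : ℝ, 0 < b₀ ∧ 2 < p₀ ∧ 0 < γ₁ ∧ γ₁ ≤ 1 ∧
      ∀ (F : T3Family) (γ : ℝ), F.L = L → 0 < γ → γ ≤ γ₁ → AveragedTailAt F γ b₀ p₀) :
    Summit.QuantumFields.YangMills.Theses.UnitScaleTilt.HistoryTailL :=
  historyTailL_of_rated (rated_of_averagedTail h)

end Feeders

end Summit.QuantumFields.YangMills.Theorems.LargeFieldMassRefinementTailRated

end
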